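import Literature.Algebra.Polynomial.CasasAlvero.Degree8Char499Closed
import Literature.Algebra.Polynomial.CasasAlvero.Degree8ScenarioCriterion
import Mathlib.Tactic.NormNum.Prime
import HarnessLib

/-!
# The Casas-Alvero conjecture in degree 8 holds in characteristic 499

This file PROVES, kernel-checked, that `499` is a GOOD prime for degree `8` in the sense of [CastryckLaterveerOunaies2012]
(`CA_8` holds in characteristic `499`):

* `holdsInDegree_eight_of_char_499` — `CA_8` over every field with `499 = 0`: the `876` reduced scenario systems are closed there
  (`degree8ScenariosClosed_of_char_499`, assembled from the kernel-evaluated certificates `Degree8Char499Cert*.lean` via `CertCheck.check`),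
  and the characteristic-free criterion `Degree8ScenariosClosed.holdsInDegree_eight` (`Degree8ScenarioCriterion.lean`) applies;
* `holdsInDegree_eight_mul_pow_of_char_499` — hence `CA_(8·499^k)` over every field of characteristic `499` ([GrafVonBothmerEtAl2007, Prop. 6] + descent).

With `CharFourHundredNinetyNinePartial.lean` this completes the classification of Casas-Alvero degrees in
characteristic `499` (`CharFourHundredNinetyNineComplete.lean`).  The certificates were found by linear algebra over `F_499` (lottery cell `code/L4lean-g15/d8/certD.py`,
kit job j140676) and are re-verified by the kernel.  No `sorry`, no new axioms.
-/

set_option linter.style.longLine false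

noncomputable section

open Polynomial

namespace Literature.Algebra.Polynomial.CasasAlvero

variable {K : Type*} [Field K]

/-- **`CA_8` in characteristic `499`.**  Over every field in which `499 = 0`, a monic polynomial of degree `8` each of whose Hasse derivatives
`H_1 f, …, H_7 f` shares a root with `f` is `(X - a)^8`: `499` is a good prime for degree `8` (it is good for degree `7` (`Degree7Char499.lean`)).
[cite: CastryckLaterveerOunaies2012, Sec. 2] -/
theorem holdsInDegree_eight_of_char_499 (hp : (499 : K) = 0) : HoldsInDegree K 8 :=
  (degree8ScenariosClosed_of_char_499 hp).holdsInDegree_eight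

/-- Hence `CA_(8·499^k)` over every field of characteristic `499`. [cite: CastryckLaterveerOunaies2012, Sec. 2] [cite: GrafVonBothmerEtAl2007, Prop. 6] -/
theorem holdsInDegree_eight_mul_pow_of_char_499 [CharP K 499] (k : ℕ) : HoldsInDegree K (8 * 499 ^ k) := by
  haveI : Fact (Nat.Prime 499) := ⟨by norm_num⟩
  exact Degree8ScenariosClosed.holdsInDegree_eight_mul_prime_pow 499
    (degree8ScenariosClosed_of_char_499 (K := AlgebraicClosure K) (by simpa using CharP.cast_eq_zero (AlgebraicClosure K) 499)) k

end Literature.Algebra.Polynomial.CasasAlvero
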